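import Summits.QuantumFields.YangMills.Theorems.FirstExitWindowFirstExitWindowTailLOfFirstExitDeep

/-!
# Route `SmallFieldWidening`, crux r3 `LargeFieldMassRefinementTail` (stmt-QuantumFields-22884), line `birth` v6 — THE UNIT-TOP NORMAL FORM of
# the one open registered stub `stub_firstExitDeep` (shared verbatim with crux `FirstExitWindowTailL`, stmt-QuantumFields-26243): the stub is
# EQUIVALENT to a window-free, height-free tail of the FULLY AVERAGED (unit-lattice) field of every run
# (support file; width seat `ym-line-sfw-p2-w2` gen 17; the stub, both cruxes and rung R3 stay OPEN)

WHAT THIS IS NOT.  No probability estimate of Bałaban's programme is proved here; `stub_firstExitDeep` is NOT proved; nothing bears on the Yang–Mills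
mass gap; rung R3 (`YM3TorusSU2`) is a RECORD rung, not the Clay statement.  This is quantifier bookkeeping over two LANDED tree facts, recorded so
that whoever attacks the stub (or types its (α)/small-field supplier) may work with the simplest equivalent statement.

THE TWO IDLE PARAMETERS OF THE STUB.  The registered stub reads: for all `L, b₀, p₀` AND ALL WINDOW CONSTANTS `b₂ ≥ b₀` there are `γ₁, C, c, N`
with, for every family `F` (`F.L = L`), `0 < γ ≤ γ₁`, every run `K`, EVERY HEIGHT `2 ≤ j ≤ K` and level-`j` plaquette `p`,
`Gibbs_K{ (∀ k < j, Ū^k is θ_{b₀}(K−k)-small) ∧ Ū^j is θ_{b₂}(K−j)-small ∧ θ_{b₀}(K−j) ≤ |Ū^j(∂p) − 1| } ≤ C·β_{K−j}^N·exp(−c·p_{b₀}(g_{K−j})²)`.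
* §1 THE WINDOW IS IDLE (`deepStub_iff_noWindow`).  Dropping the clause «`Ū^j` is `θ_{b₂}(K−j)`-small» only ENLARGES the event, so the
  window-free tail implies the stub for every `b₂`; conversely, by the LANDED deterministic window `OneStepWindowL` (stmt-QuantumFields-26244,
  `firstExitWindow_oneStepWindowL_proof`: `θ_{b₀}(K−j+1)`-smallness of `Ū^{j−1}` forces `θ_{b₂(L,b₀,p₀)}(K−j)`-smallness of `Ū^j` below a
  coupling threshold) the window-free event is CONTAINED in the windowed one at the window's own `b₂`, so the stub at that one `b₂` gives the
  window-free tail.  Hence the `∀ b₂` quantifier and the middle clause carry no content.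
* §2 THE HEIGHT IS IDLE (`noWindow_iff_unitTop`).  By the tree's LEVEL SHIFT (`T3LevelShift.fieldShift`: run `j + d` of `F` and run `j` of the
  refined family `F.refine d` at coupling `γL^{-d}` have the same finest lattice, the same Wilson weight `β`, block averagings corresponding
  level by level `iter_fieldShift`, and thresholds `θ_{γL^{-d}}(i) = θ_γ(i + d)`), the first-exit event at height `j` of run `K = j + d` of `F`
  IS the first-exit event AT THE UNIT LATTICE (height `j` of the `j`-step run) of `F.refine d`, with the same Gibbs mass
  (`gibbsK_real_firstExit_eq_refine`) and the same bound (`β_{K−j} = (γL^{-d})⁻¹`).  Since the stub quantifies over ALL families of block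
  size `L` (all volumes) and all `γ ≤ γ₁` (and `γL^{-d} ≤ γ`), it is equivalent to its own `j = K` instances.
* §3 THE NORMAL FORM (`deepStub_iff_unitTop`) and the by-name certificates: `UnitTop` :=
  `∀ L b₀ p₀ (0 < b₀) (2 < p₀), ∃ γ₁ ∈ (0,1], C ≥ 0, c > 0, N, ∀ F (F.L = L), ∀ γ ∈ (0, γ₁], ∀ K ≥ 2, ∀ unit plaquette p of run K,
   Gibbs_K{ every sub-unit block field Ū^k (k < K) is θ_{b₀}(K−k)-small ∧ θ_{b₀}(0) ≤ |Ū^K(∂p) − 1| } ≤ C·γ^{-N}·exp(−c·p_{b₀}(√γ)²)`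
  — «in every run, uniformly in its length `K ≥ 2` and in the volume, a `b₀`-LARGE UNIT PLAQUETTE OF THE FULLY AVERAGED FIELD ON TOP OF A
  `b₀`-SMALL SUB-UNIT HISTORY costs `C γ^{-N} e^{−c p(√γ)²}`» — is equivalent to `stub_firstExitDeep`, hence (landed certificates
  `firstExitWindowTailL_of_firstExitDeep`, `…_of_firstExitWindowTailL`) implies `FirstExitWindowTailL` (26243), r3 `LargeFieldMassRefinementTail`
  (22884) and K2′ `HistoryTailL` (19936) BY NAME.  The unit-lattice law restricted to a small sub-unit history is exactly the object Bałaban's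
  terminal small-field densities describe ([Balaban1985UV3] (41) p.266, (70)–(71) p.273: «the function χ(…) exp(…) restricted to the large
  plaquette variables … can be estimated by exp(−c p(g_k)²)» — printed for densities, not as a probability bound); the tree's
  `T3RestrictedUnitDensity.map_unitA_restrict_eq_withDensity` reads `UnitTop` on those densities.

References: T. Bałaban, Commun. Math. Phys. **102** (1985) 255–275 [Balaban1985UV3] ((1)–(3) p.256, (7) p.257, (41) p.266, (70)–(71) p.273);
CMP **109** (1987) 249–301 [Balaban1987RG1] ((0.1) p.251, (0.4)/(0.11) p.253); CMP **98** (1985) 17–51 [Balaban1985Averaging] ((10) p.19,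
Prop. 1 (51) p.26).
-/

noncomputable section

open MeasureTheory
open Literature.MathematicalPhysics.QuantumFieldTheory.Balaban1983to89
open Literature.MathematicalPhysics.QuantumFieldTheory.Balaban1983to89.Missing
open Literature.MathematicalPhysics.QuantumFieldTheory.Balaban1983to89.T3ContinuumYM3Torus
open Literature.MathematicalPhysics.QuantumFieldTheory.Balaban1983to89.T3UnitScaleTilt
open Literature.MathematicalPhysics.QuantumFieldTheory.Balaban1983to89.T3UnitLawDensityEML (ℰp measurableE_ℰp)
open Literature.MathematicalPhysics.QuantumFieldTheory.Balaban1983to89.T3LevelShift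
open Literature.MathematicalPhysics.QuantumFieldTheory.Balaban1983to89.T3ThresholdRemoval
open Summit.QuantumFields.YangMills.Theorems.LargeFieldMassRefinementTailOfHeightTail (θBal_mul_pow plaqSmall_fieldShift_iff)

namespace Summit.QuantumFields.YangMills.Theorems.LargeFieldMassRefinementTailUnitTop

/-! ## §0 Two towers with one finest lattice carry one Gibbs measure: the set-level form (any set, via the measurable equivalence) -/

section Transport

variable {F : T3Family} {m K m' K' : ℕ} {G : Type*} [GaugeGroup G] [MeasurableSpace G] [HaarData G] [RegularGaugeGroup G]

/-- **ONE GIBBS MEASURE ON TWO TOWERS, AS MEASURES**: for towers `(m, K)`, `(m′, K′)` of one family with equal finest lattices, the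
push-forward of the Wilson–Gibbs measure of `(m′, K′)` under the level identification `fieldShift h` IS the Wilson–Gibbs measure of `(m, K)` at the
same `β ≥ 0` (the tree's `integral_gibbsMeasure_comp_fieldShift`, read on indicators). [cite: Balaban1985UV3, (1)-(3) p.256] -/
theorem gibbsMeasure_map_fieldShift (h : (F.PP m K).sitesPerDir 0 = (F.PP m' K').sitesPerDir 0) {β : ℝ} (hβ : 0 ≤ β) :
    (T4GenFunBounds.gibbsMeasure (G := G) (F.PP m' K') β).map (fieldShift h) =
      T4GenFunBounds.gibbsMeasure (G := G) (F.PP m K) β := by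
  haveI := T4GenFunBounds.isProbabilityMeasure_gibbsMeasure (G := G) (F.PP m' K') hβ
  haveI := T4GenFunBounds.isProbabilityMeasure_gibbsMeasure (G := G) (F.PP m K) hβ
  refine Measure.ext fun s hs => ?_
  rw [Measure.map_apply (measurable_fieldShift h) hs]
  have key := integral_gibbsMeasure_comp_fieldShift (G := G) h hβ (s.indicator 1)
  have hind : (fun V : GaugeField (F.PP m' K') 0 G => s.indicator (1 : GaugeField (F.PP m K) 0 G → ℝ) (fieldShift h V)) =
      (fieldShift h ⁻¹' s).indicator 1 := by
    funext V
    by_cases hV : fieldShift h V ∈ s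
    · rw [Set.indicator_of_mem hV, Set.indicator_of_mem (Set.mem_preimage.mpr hV)]
      rfl
    · rw [Set.indicator_of_notMem hV, Set.indicator_of_notMem (fun h' => hV (Set.mem_preimage.mp h'))]
  rw [hind, integral_indicator_one ((measurable_fieldShift h) hs), integral_indicator_one hs,
    measureReal_def, measureReal_def] at key
  exact (ENNReal.toReal_eq_toReal_iff' (measure_ne_top _ _) (measure_ne_top _ _)).mp key

omit [GaugeGroup G] [HaarData G] [RegularGaugeGroup G] in
/-- `fieldShift h` is a measurable EMBEDDING (indeed a measurable equivalence: a reindexing of the bond coordinates,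
`MeasurableEquiv.piCongrLeft`). [cite: Balaban1985Averaging, (10) p.19] -/
theorem measurableEmbedding_fieldShift {j j' : ℕ} (h : (F.PP m K).sitesPerDir j = (F.PP m' K').sitesPerDir j') :
    MeasurableEmbedding (fieldShift h : GaugeField (F.PP m' K') j' G → GaugeField (F.PP m K) j G) := by
  have hme := (MeasurableEquiv.piCongrLeft (fun _ : PBond (F.PP m' K') j' => G) (bondShift h)).symm.measurableEmbedding
  have hcoe : ⇑(MeasurableEquiv.piCongrLeft (fun _ : PBond (F.PP m' K') j' => G) (bondShift h)).symm =
      (fieldShift h : GaugeField (F.PP m' K') j' G → GaugeField (F.PP m K) j G) :=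
    funext (piCongrLeft_bondShift_symm_apply h)
  rw [hcoe] at hme
  exact hme

/-- **THE SAME FOR EVERY SET** (no measurability needed: `fieldShift h` is a measurable embedding):
`Gibbs_{(m′,K′)}(fieldShift h ⁻¹ S) = Gibbs_{(m,K)}(S)`. [cite: Balaban1985UV3, (1)-(3) p.256] -/
theorem gibbsMeasure_preimage_fieldShift (h : (F.PP m K).sitesPerDir 0 = (F.PP m' K').sitesPerDir 0) {β : ℝ} (hβ : 0 ≤ β)
    (S : Set (GaugeField (F.PP m K) 0 G)) :
    T4GenFunBounds.gibbsMeasure (G := G) (F.PP m' K') β (fieldShift h ⁻¹' S) =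
      T4GenFunBounds.gibbsMeasure (G := G) (F.PP m K) β S := by
  rw [← gibbsMeasure_map_fieldShift h hβ]
  exact ((measurableEmbedding_fieldShift (G := G) h).map_apply _ S).symm

/-- Real-valued form: `Gibbs_{(m′,K′)}.real (fieldShift h ⁻¹ S) = Gibbs_{(m,K)}.real S`. [cite: Balaban1985UV3, (1)-(3) p.256] -/
theorem gibbsMeasure_real_preimage_fieldShift (h : (F.PP m K).sitesPerDir 0 = (F.PP m' K').sitesPerDir 0) {β : ℝ} (hβ : 0 ≤ β)
    (S : Set (GaugeField (F.PP m K) 0 G)) :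
    (T4GenFunBounds.gibbsMeasure (G := G) (F.PP m' K') β).real (fieldShift h ⁻¹' S) =
      (T4GenFunBounds.gibbsMeasure (G := G) (F.PP m K) β).real S := by
  rw [measureReal_def, measureReal_def, gibbsMeasure_preimage_fieldShift h hβ S]

end Transport

/-! ## §1 The window is idle -/

section Window

/-- **WINDOW-FREE ⇒ WINDOWED** (for every `b₂`): dropping the clause «`Ū^j` is `θ_{b₂}(K−j)`-small» enlarges the first-exit event, so a bound on the
window-free event bounds the stub's event with the same constants. [cite: Balaban1985UV3, (7) p.257] -/
theorem deepStub_of_noWindow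
    (hNW : ∀ (L : ℕ) (b₀ p₀ : ℝ), 0 < b₀ → 2 < p₀ → ∃ (γ₁ C c : ℝ) (N : ℕ), 0 < γ₁ ∧ γ₁ ≤ 1 ∧ 0 < c ∧ 0 ≤ C ∧
      ∀ (F : T3Family) (γ : ℝ), F.L = L → 0 < γ → γ ≤ γ₁ → ∀ (K j : ℕ), 2 ≤ j → j ≤ K → ∀ p : Plaq (F.P K) j,
        (gibbsK F ℰp γ K).real {U | (∀ k, k < j → PlaqSmall (θBal F.L γ b₀ p₀ (K - k))
            (Averaging.iter (fun i => BlockAveraging.blockAvg (P := F.P K) (j := i) ℰp) k U)) ∧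
          θBal F.L γ b₀ p₀ (K - j) ≤ GaugeGroup.dist1 (GaugeField.plaqHol
            (Averaging.iter (fun i => BlockAveraging.blockAvg (P := F.P K) (j := i) ℰp) j U) p)} ≤
        C * ((γ * ((F.L : ℝ)⁻¹) ^ (K - j))⁻¹) ^ N * Real.exp (-(c * B10.pFun b₀ p₀ (Real.sqrt (γ * ((F.L : ℝ)⁻¹) ^ (K - j))) ^ 2))) :
    ∀ (L : ℕ) (b₀ p₀ b₂ : ℝ), 0 < b₀ → 2 < p₀ → b₀ ≤ b₂ → ∃ (γ₁ C c : ℝ) (N : ℕ), 0 < γ₁ ∧ γ₁ ≤ 1 ∧ 0 < c ∧ 0 ≤ C ∧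
      ∀ (F : T3Family) (γ : ℝ), F.L = L → 0 < γ → γ ≤ γ₁ → ∀ (K j : ℕ), 2 ≤ j → j ≤ K → ∀ p : Plaq (F.P K) j,
        (gibbsK F ℰp γ K).real {U | (∀ k, k < j → PlaqSmall (θBal F.L γ b₀ p₀ (K - k))
            (Averaging.iter (fun i => BlockAveraging.blockAvg (P := F.P K) (j := i) ℰp) k U)) ∧
          PlaqSmall (θBal F.L γ b₂ p₀ (K - j)) (Averaging.iter (fun i => BlockAveraging.blockAvg (P := F.P K) (j := i) ℰp) j U) ∧
          θBal F.L γ b₀ p₀ (K - j) ≤ GaugeGroup.dist1 (GaugeField.plaqHol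
            (Averaging.iter (fun i => BlockAveraging.blockAvg (P := F.P K) (j := i) ℰp) j U) p)} ≤
        C * ((γ * ((F.L : ℝ)⁻¹) ^ (K - j))⁻¹) ^ N * Real.exp (-(c * B10.pFun b₀ p₀ (Real.sqrt (γ * ((F.L : ℝ)⁻¹) ^ (K - j))) ^ 2)) := by
  intro L b₀ p₀ b₂ hb₀ hp₀ _hb₂
  obtain ⟨γ₁, C, c, N, hγ₁, hγ₁1, hc, hC, h⟩ := hNW L b₀ p₀ hb₀ hp₀
  refine ⟨γ₁, C, c, N, hγ₁, hγ₁1, hc, hC, fun F γ hFL hγ hle K j hj hjK p => ?_⟩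
  haveI := isProbabilityMeasure_gibbsK F ℰp hγ.le K
  refine (measureReal_mono ?_ (measure_ne_top _ _)).trans (h F γ hFL hγ hle K j hj hjK p)
  intro U hU
  exact ⟨hU.1, hU.2.2⟩

/-- **WINDOWED (at the window's own `b₂`) ⇒ WINDOW-FREE**: by the landed deterministic window `OneStepWindowL` (`firstExitWindow_oneStepWindowL_proof`),
below its coupling threshold the `θ_{b₀}(K−j+1)`-smallness of `Ū^{j−1}` (part of the small history) forces `θ_{b₂}(K−j)`-smallness of `Ū^{j}`, so the
window-free first-exit event is contained in the windowed one; the stub at that single `b₂` gives the window-free tail (coupling threshold `min`).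
[cite: Balaban1985Averaging, Prop. 1 (51) p.26; Balaban1985UV3, (7) p.257] -/
theorem noWindow_of_deepStub
    (hD : ∀ (L : ℕ) (b₀ p₀ b₂ : ℝ), 0 < b₀ → 2 < p₀ → b₀ ≤ b₂ → ∃ (γ₁ C c : ℝ) (N : ℕ), 0 < γ₁ ∧ γ₁ ≤ 1 ∧ 0 < c ∧ 0 ≤ C ∧
      ∀ (F : T3Family) (γ : ℝ), F.L = L → 0 < γ → γ ≤ γ₁ → ∀ (K j : ℕ), 2 ≤ j → j ≤ K → ∀ p : Plaq (F.P K) j,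
        (gibbsK F ℰp γ K).real {U | (∀ k, k < j → PlaqSmall (θBal F.L γ b₀ p₀ (K - k))
            (Averaging.iter (fun i => BlockAveraging.blockAvg (P := F.P K) (j := i) ℰp) k U)) ∧
          PlaqSmall (θBal F.L γ b₂ p₀ (K - j)) (Averaging.iter (fun i => BlockAveraging.blockAvg (P := F.P K) (j := i) ℰp) j U) ∧
          θBal F.L γ b₀ p₀ (K - j) ≤ GaugeGroup.dist1 (GaugeField.plaqHol
            (Averaging.iter (fun i => BlockAveraging.blockAvg (P := F.P K) (j := i) ℰp) j U) p)} ≤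
        C * ((γ * ((F.L : ℝ)⁻¹) ^ (K - j))⁻¹) ^ N * Real.exp (-(c * B10.pFun b₀ p₀ (Real.sqrt (γ * ((F.L : ℝ)⁻¹) ^ (K - j))) ^ 2))) :
    ∀ (L : ℕ) (b₀ p₀ : ℝ), 0 < b₀ → 2 < p₀ → ∃ (γ₁ C c : ℝ) (N : ℕ), 0 < γ₁ ∧ γ₁ ≤ 1 ∧ 0 < c ∧ 0 ≤ C ∧
      ∀ (F : T3Family) (γ : ℝ), F.L = L → 0 < γ → γ ≤ γ₁ → ∀ (K j : ℕ), 2 ≤ j → j ≤ K → ∀ p : Plaq (F.P K) j,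
        (gibbsK F ℰp γ K).real {U | (∀ k, k < j → PlaqSmall (θBal F.L γ b₀ p₀ (K - k))
            (Averaging.iter (fun i => BlockAveraging.blockAvg (P := F.P K) (j := i) ℰp) k U)) ∧
          θBal F.L γ b₀ p₀ (K - j) ≤ GaugeGroup.dist1 (GaugeField.plaqHol
            (Averaging.iter (fun i => BlockAveraging.blockAvg (P := F.P K) (j := i) ℰp) j U) p)} ≤
        C * ((γ * ((F.L : ℝ)⁻¹) ^ (K - j))⁻¹) ^ N * Real.exp (-(c * B10.pFun b₀ p₀ (Real.sqrt (γ * ((F.L : ℝ)⁻¹) ^ (K - j))) ^ 2)) := by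
  intro L b₀ p₀ hb₀ hp₀
  obtain ⟨b₂, γw, hb₂, hγw, _hγw1, hwin⟩ := firstExitWindow_oneStepWindowL_proof L b₀ p₀ hb₀ hp₀
  obtain ⟨γ₁, C, c, N, hγ₁, hγ₁1, hc, hC, h⟩ := hD L b₀ p₀ b₂ hb₀ hp₀ hb₂
  refine ⟨min γ₁ γw, C, c, N, lt_min hγ₁ hγw, (min_le_left _ _).trans hγ₁1, hc, hC,
    fun F γ hFL hγ hle K j hj hjK p => ?_⟩
  haveI := isProbabilityMeasure_gibbsK F ℰp hγ.le K
  refine (measureReal_mono ?_ (measure_ne_top _ _)).trans (h F γ hFL hγ (hle.trans (min_le_left _ _)) K j hj hjK p)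
  -- write `j = j' + 1`; the window at level `j'` applies to the small history at `k = j'`
  obtain ⟨j', rfl⟩ : ∃ j', j = j' + 1 := ⟨j - 1, by omega⟩
  intro U hU
  exact ⟨hU.1, hwin F γ hFL hγ (hle.trans (min_le_right _ _)) K j' hjK U (hU.1 j' (Nat.lt_succ_self j')), hU.2⟩

end Window

/-! ## §2 The height is idle: the first-exit event at height `j` of run `j + d` of `F` is the unit-top event of run `j` of `F.refine d` -/

section Height

variable (F : T3Family)

/-- **THE EVENT AND MASS IDENTIFICATION UNDER THE LEVEL SHIFT**: for a profile `(b₀, p₀)`, a coupling `γ ≥ 0`, a depth `d`, a run length `j` and a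
level-`j` plaquette `p` of run `j + d` of `F`, the Gibbs mass of the window-free first-exit event «`∀ k < j`, `Ū^k` is `θ_γ(j+d−k)`-small ∧
`θ_γ(d) ≤ |Ū^j(∂p) − 1|`» EQUALS the Gibbs mass, for run `j` of the refined family `F.refine d` at coupling `γL^{-d}`, of the UNIT-TOP event
«`∀ k < j`, `Ū^k` is `θ_{γL^{-d}}(j−k)`-small ∧ `θ_{γL^{-d}}(0) ≤ |Ū^j(∂p′) − 1|» at the corresponding unit plaquette `p′ = plaqShift p` — same finest
lattice, same Wilson weight (`refine_β`), block averagings and plaquettes corresponding under `fieldShift` (`iter_fieldShift`, `plaqHol_fieldShift`),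
thresholds `θ_{γL^{-d}}(i) = θ_γ(i + d)`. [cite: Balaban1985UV3, (1)-(3) p.256 and (7) p.257; Balaban1987RG1, (0.11) p.253] -/
theorem gibbsK_real_firstExit_eq_refine (γ : ℝ) (hγ : 0 ≤ γ) (b₀ p₀ : ℝ) (d j : ℕ) (p : Plaq (F.P (j + d)) j) :
    (gibbsK F ℰp γ (j + d)).real {U | (∀ k, k < j → PlaqSmall (θBal F.L γ b₀ p₀ (j + d - k))
          (Averaging.iter (fun i => BlockAveraging.blockAvg (P := F.P (j + d)) (j := i) ℰp) k U)) ∧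
        θBal F.L γ b₀ p₀ d ≤ GaugeGroup.dist1 (GaugeField.plaqHol
          (Averaging.iter (fun i => BlockAveraging.blockAvg (P := F.P (j + d)) (j := i) ℰp) j U) p)} =
      (gibbsK (F.refine d) ℰp (γ * ((F.L : ℝ)⁻¹) ^ d) j).real
        {V | (∀ k, k < j → PlaqSmall (θBal F.L (γ * ((F.L : ℝ)⁻¹) ^ d) b₀ p₀ (j - k))
            (Averaging.iter (fun i => BlockAveraging.blockAvg (P := (F.refine d).P j) (j := i) ℰp) k V)) ∧
          θBal F.L (γ * ((F.L : ℝ)⁻¹) ^ d) b₀ p₀ 0 ≤ GaugeGroup.dist1 (GaugeField.plaqHol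
            (Averaging.iter (fun i => BlockAveraging.blockAvg (P := (F.refine d).P j) (j := i) ℰp) j V)
            (plaqShift (F.sitesPerDir_eq (m := F.m) (K := j + d) (j := j) (m' := F.m + d) (K' := j) (j' := j) (by omega)) p))} := by
  have hmK : F.m + (j + d) = F.m + d + j := by omega
  have hβ : ((F.refine d).scheme ℰp (γ * ((F.L : ℝ)⁻¹) ^ d)).β j = (F.scheme ℰp γ).β (j + d) := F.refine_β ℰp γ d j
  have hβ0 : 0 ≤ (F.scheme ℰp γ).β (j + d) := F.scheme_β_nonneg ℰp hγ (j + d)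
  rw [gibbsK_eq, gibbsK_eq, hβ]
  refine (gibbsMeasure_real_preimage_fieldShift (G := Matrix.specialUnitaryGroup (Fin 2) ℂ)
    (sitesPerDir_refine_zero F d j) hβ0 _).symm.trans ?_
  congr 1
  ext V
  simp only [Set.mem_preimage]
  -- thresholds: `θ_{γL^{-d}}(i) = θ_γ(i + d)`
  simp only [θBal_mul_pow]
  constructor
  · rintro ⟨hhist, hexit⟩
    refine ⟨fun k hk => ?_, ?_⟩
    · have hk' := hhist k hk
      have key := iter_fieldShift ℰp hmK k V
      erw [key, plaqSmall_fieldShift_iff] at hk'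
      rw [show j + d - k = j - k + d by omega] at hk'
      exact hk'
    · have key := iter_fieldShift ℰp hmK j V
      erw [key, plaqHol_fieldShift] at hexit
      simp only [zero_add]
      exact hexit
  · rintro ⟨hhist, hexit⟩
    refine ⟨fun k hk => ?_, ?_⟩
    · have hk' := hhist k hk
      have key := iter_fieldShift ℰp hmK k V
      erw [key, plaqSmall_fieldShift_iff]
      rw [show j + d - k = j - k + d by omega]
      exact hk'
    · have key := iter_fieldShift ℰp hmK j V
      erw [key, plaqHol_fieldShift]
      simp only [zero_add] at hexit
      exact hexit

/-- **UNIT-TOP ⇒ WINDOW-FREE AT EVERY HEIGHT**: the unit-top tail for ALL families of block size `L` (all volumes) and all `γ ≤ γ₁` gives the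
window-free first-exit tail at every height `2 ≤ j ≤ K`, with the SAME constants — apply it to `F.refine (K − j)` at `γL^{-(K−j)} ≤ γ` and transport
(`gibbsK_real_firstExit_eq_refine`). [cite: Balaban1985UV3, (1)-(3) p.256 and (7) p.257] -/
theorem noWindow_of_unitTop
    (hU : ∀ (L : ℕ) (b₀ p₀ : ℝ), 0 < b₀ → 2 < p₀ → ∃ (γ₁ C c : ℝ) (N : ℕ), 0 < γ₁ ∧ γ₁ ≤ 1 ∧ 0 < c ∧ 0 ≤ C ∧
      ∀ (F : T3Family) (γ : ℝ), F.L = L → 0 < γ → γ ≤ γ₁ → ∀ (K : ℕ), 2 ≤ K → ∀ p : Plaq (F.P K) K,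
        (gibbsK F ℰp γ K).real {U | (∀ k, k < K → PlaqSmall (θBal F.L γ b₀ p₀ (K - k))
            (Averaging.iter (fun i => BlockAveraging.blockAvg (P := F.P K) (j := i) ℰp) k U)) ∧
          θBal F.L γ b₀ p₀ 0 ≤ GaugeGroup.dist1 (GaugeField.plaqHol
            (Averaging.iter (fun i => BlockAveraging.blockAvg (P := F.P K) (j := i) ℰp) K U) p)} ≤
        C * (γ⁻¹) ^ N * Real.exp (-(c * B10.pFun b₀ p₀ (Real.sqrt γ) ^ 2))) :
    ∀ (L : ℕ) (b₀ p₀ : ℝ), 0 < b₀ → 2 < p₀ → ∃ (γ₁ C c : ℝ) (N : ℕ), 0 < γ₁ ∧ γ₁ ≤ 1 ∧ 0 < c ∧ 0 ≤ C ∧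
      ∀ (F : T3Family) (γ : ℝ), F.L = L → 0 < γ → γ ≤ γ₁ → ∀ (K j : ℕ), 2 ≤ j → j ≤ K → ∀ p : Plaq (F.P K) j,
        (gibbsK F ℰp γ K).real {U | (∀ k, k < j → PlaqSmall (θBal F.L γ b₀ p₀ (K - k))
            (Averaging.iter (fun i => BlockAveraging.blockAvg (P := F.P K) (j := i) ℰp) k U)) ∧
          θBal F.L γ b₀ p₀ (K - j) ≤ GaugeGroup.dist1 (GaugeField.plaqHol
            (Averaging.iter (fun i => BlockAveraging.blockAvg (P := F.P K) (j := i) ℰp) j U) p)} ≤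
        C * ((γ * ((F.L : ℝ)⁻¹) ^ (K - j))⁻¹) ^ N * Real.exp (-(c * B10.pFun b₀ p₀ (Real.sqrt (γ * ((F.L : ℝ)⁻¹) ^ (K - j))) ^ 2)) := by
  intro L b₀ p₀ hb₀ hp₀
  obtain ⟨γ₁, C, c, N, hγ₁, hγ₁1, hc, hC, h⟩ := hU L b₀ p₀ hb₀ hp₀
  refine ⟨γ₁, C, c, N, hγ₁, hγ₁1, hc, hC, fun F γ hFL hγ hle K j hj hjK p => ?_⟩
  -- write `K = j + d`
  obtain ⟨d, rfl⟩ := Nat.exists_eq_add_of_le hjK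
  have hL1 : (1 : ℝ) ≤ F.L := by exact_mod_cast F.hL.2.le
  have hq0 : (0 : ℝ) < ((F.L : ℝ)⁻¹) ^ d := pow_pos (inv_pos.mpr (by linarith)) d
  have hq1 : ((F.L : ℝ)⁻¹) ^ d ≤ 1 := pow_le_one₀ (inv_nonneg.mpr (by linarith)) (inv_le_one_of_one_le₀ hL1)
  have hγ' : 0 < γ * ((F.L : ℝ)⁻¹) ^ d := mul_pos hγ hq0
  have hγ'le : γ * ((F.L : ℝ)⁻¹) ^ d ≤ γ₁ := (mul_le_of_le_one_right hγ.le hq1).trans hle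
  have happ := h (F.refine d) (γ * ((F.L : ℝ)⁻¹) ^ d) hFL hγ' hγ'le j hj
    (plaqShift (F.sitesPerDir_eq (m := F.m) (K := j + d) (j := j) (m' := F.m + d) (K' := j) (j' := j) (by omega)) p)
  rw [show j + d - j = d from Nat.add_sub_cancel_left j d, gibbsK_real_firstExit_eq_refine F γ hγ.le b₀ p₀ d j p]
  exact happ

/-- **WINDOW-FREE AT EVERY HEIGHT ⇒ UNIT-TOP**: the `j = K` instances (`K − K = 0`, `γ·L⁰ = γ`). [cite: Balaban1985UV3, (7) p.257] -/
theorem unitTop_of_noWindow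
    (hNW : ∀ (L : ℕ) (b₀ p₀ : ℝ), 0 < b₀ → 2 < p₀ → ∃ (γ₁ C c : ℝ) (N : ℕ), 0 < γ₁ ∧ γ₁ ≤ 1 ∧ 0 < c ∧ 0 ≤ C ∧
      ∀ (F : T3Family) (γ : ℝ), F.L = L → 0 < γ → γ ≤ γ₁ → ∀ (K j : ℕ), 2 ≤ j → j ≤ K → ∀ p : Plaq (F.P K) j,
        (gibbsK F ℰp γ K).real {U | (∀ k, k < j → PlaqSmall (θBal F.L γ b₀ p₀ (K - k))
            (Averaging.iter (fun i => BlockAveraging.blockAvg (P := F.P K) (j := i) ℰp) k U)) ∧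
          θBal F.L γ b₀ p₀ (K - j) ≤ GaugeGroup.dist1 (GaugeField.plaqHol
            (Averaging.iter (fun i => BlockAveraging.blockAvg (P := F.P K) (j := i) ℰp) j U) p)} ≤
        C * ((γ * ((F.L : ℝ)⁻¹) ^ (K - j))⁻¹) ^ N * Real.exp (-(c * B10.pFun b₀ p₀ (Real.sqrt (γ * ((F.L : ℝ)⁻¹) ^ (K - j))) ^ 2))) :
    ∀ (L : ℕ) (b₀ p₀ : ℝ), 0 < b₀ → 2 < p₀ → ∃ (γ₁ C c : ℝ) (N : ℕ), 0 < γ₁ ∧ γ₁ ≤ 1 ∧ 0 < c ∧ 0 ≤ C ∧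
      ∀ (F : T3Family) (γ : ℝ), F.L = L → 0 < γ → γ ≤ γ₁ → ∀ (K : ℕ), 2 ≤ K → ∀ p : Plaq (F.P K) K,
        (gibbsK F ℰp γ K).real {U | (∀ k, k < K → PlaqSmall (θBal F.L γ b₀ p₀ (K - k))
            (Averaging.iter (fun i => BlockAveraging.blockAvg (P := F.P K) (j := i) ℰp) k U)) ∧
          θBal F.L γ b₀ p₀ 0 ≤ GaugeGroup.dist1 (GaugeField.plaqHol
            (Averaging.iter (fun i => BlockAveraging.blockAvg (P := F.P K) (j := i) ℰp) K U) p)} ≤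
        C * (γ⁻¹) ^ N * Real.exp (-(c * B10.pFun b₀ p₀ (Real.sqrt γ) ^ 2)) := by
  intro L b₀ p₀ hb₀ hp₀
  obtain ⟨γ₁, C, c, N, hγ₁, hγ₁1, hc, hC, h⟩ := hNW L b₀ p₀ hb₀ hp₀
  refine ⟨γ₁, C, c, N, hγ₁, hγ₁1, hc, hC, fun F γ hFL hγ hle K hK p => ?_⟩
  have happ := h F γ hFL hγ hle K K hK le_rfl p
  simp only [Nat.sub_self, pow_zero, mul_one] at happ
  exact happ

end Height

/-! ## §3 The normal form of the registered stub and the by-name certificates -/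

section NormalForm

/-- **THE UNIT-TOP NORMAL FORM OF `stub_firstExitDeep`** (crux stmt-QuantumFields-26243 = the one registered stub of crux stmt-QuantumFields-22884, text
verbatim on the left): the stub is EQUIVALENT to «for every block size `L` and profile `0 < b₀`, `2 < p₀` there are `γ₁ ∈ (0,1]`, `C ≥ 0`, `c > 0`, `N`
such that in EVERY run `K ≥ 2` of EVERY family of block size `L`, at every `0 < γ ≤ γ₁` and every UNIT plaquette `p`, the Gibbs mass of «all sub-unit
block fields `Ū^k` (`k < K`) are `θ_{b₀}(K−k)`-small ∧ `θ_{b₀}(0) ≤ |Ū^K(∂p) − 1|» is `≤ C·γ^{-N}·exp(−c·p_{b₀}(√γ)²)`» — no window, no height.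
[cite: Balaban1985UV3, (7) p.257 and (70)-(71) p.273] -/
theorem deepStub_iff_unitTop :
    (∀ (L : ℕ) (b₀ p₀ b₂ : ℝ), 0 < b₀ → 2 < p₀ → b₀ ≤ b₂ → ∃ (γ₁ C c : ℝ) (N : ℕ), 0 < γ₁ ∧ γ₁ ≤ 1 ∧ 0 < c ∧ 0 ≤ C ∧
      ∀ (F : T3Family) (γ : ℝ), F.L = L → 0 < γ → γ ≤ γ₁ → ∀ (K j : ℕ), 2 ≤ j → j ≤ K → ∀ p : Plaq (F.P K) j,
        (gibbsK F ℰp γ K).real {U | (∀ k, k < j → PlaqSmall (θBal F.L γ b₀ p₀ (K - k))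
            (Averaging.iter (fun i => BlockAveraging.blockAvg (P := F.P K) (j := i) ℰp) k U)) ∧
          PlaqSmall (θBal F.L γ b₂ p₀ (K - j)) (Averaging.iter (fun i => BlockAveraging.blockAvg (P := F.P K) (j := i) ℰp) j U) ∧
          θBal F.L γ b₀ p₀ (K - j) ≤ GaugeGroup.dist1 (GaugeField.plaqHol
            (Averaging.iter (fun i => BlockAveraging.blockAvg (P := F.P K) (j := i) ℰp) j U) p)} ≤
        C * ((γ * ((F.L : ℝ)⁻¹) ^ (K - j))⁻¹) ^ N * Real.exp (-(c * B10.pFun b₀ p₀ (Real.sqrt (γ * ((F.L : ℝ)⁻¹) ^ (K - j))) ^ 2))) ↔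
    (∀ (L : ℕ) (b₀ p₀ : ℝ), 0 < b₀ → 2 < p₀ → ∃ (γ₁ C c : ℝ) (N : ℕ), 0 < γ₁ ∧ γ₁ ≤ 1 ∧ 0 < c ∧ 0 ≤ C ∧
      ∀ (F : T3Family) (γ : ℝ), F.L = L → 0 < γ → γ ≤ γ₁ → ∀ (K : ℕ), 2 ≤ K → ∀ p : Plaq (F.P K) K,
        (gibbsK F ℰp γ K).real {U | (∀ k, k < K → PlaqSmall (θBal F.L γ b₀ p₀ (K - k))
            (Averaging.iter (fun i => BlockAveraging.blockAvg (P := F.P K) (j := i) ℰp) k U)) ∧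
          θBal F.L γ b₀ p₀ 0 ≤ GaugeGroup.dist1 (GaugeField.plaqHol
            (Averaging.iter (fun i => BlockAveraging.blockAvg (P := F.P K) (j := i) ℰp) K U) p)} ≤
        C * (γ⁻¹) ^ N * Real.exp (-(c * B10.pFun b₀ p₀ (Real.sqrt γ) ^ 2))) :=
  ⟨fun hD => unitTop_of_noWindow (noWindow_of_deepStub hD), fun hU => deepStub_of_noWindow (noWindow_of_unitTop hU)⟩

/-- **`FirstExitWindowTailL` (crux stmt-QuantumFields-26243) ⇐ THE UNIT-TOP TAIL** (normal form + the landed `firstExitWindowTailL_of_firstExitDeep`,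
which merges in the landed first averaged level `stub_firstExitOne`).  Conditional certificate; nothing about the mass gap. [cite: Balaban1985UV3, (7) p.257 and (71) p.273] -/
theorem firstExitWindowTailL_of_unitTop
    (hU : ∀ (L : ℕ) (b₀ p₀ : ℝ), 0 < b₀ → 2 < p₀ → ∃ (γ₁ C c : ℝ) (N : ℕ), 0 < γ₁ ∧ γ₁ ≤ 1 ∧ 0 < c ∧ 0 ≤ C ∧
      ∀ (F : T3Family) (γ : ℝ), F.L = L → 0 < γ → γ ≤ γ₁ → ∀ (K : ℕ), 2 ≤ K → ∀ p : Plaq (F.P K) K,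
        (gibbsK F ℰp γ K).real {U | (∀ k, k < K → PlaqSmall (θBal F.L γ b₀ p₀ (K - k))
            (Averaging.iter (fun i => BlockAveraging.blockAvg (P := F.P K) (j := i) ℰp) k U)) ∧
          θBal F.L γ b₀ p₀ 0 ≤ GaugeGroup.dist1 (GaugeField.plaqHol
            (Averaging.iter (fun i => BlockAveraging.blockAvg (P := F.P K) (j := i) ℰp) K U) p)} ≤
        C * (γ⁻¹) ^ N * Real.exp (-(c * B10.pFun b₀ p₀ (Real.sqrt γ) ^ 2))) :
    Summit.QuantumFields.YangMills.Theses.FirstExitWindow.FirstExitWindowTailL :=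
  FirstExitWindow.firstExitWindowTailL_of_firstExitDeep (deepStub_iff_unitTop.mpr hU)

/-- **r3 `LargeFieldMassRefinementTail` (crux stmt-QuantumFields-22884) ⇐ THE UNIT-TOP TAIL.**  Conditional certificate; nothing about the mass gap.
[cite: Balaban1985UV3, (7) p.257 and (71) p.273] -/
theorem largeFieldMassRefinementTail_of_unitTop
    (hU : ∀ (L : ℕ) (b₀ p₀ : ℝ), 0 < b₀ → 2 < p₀ → ∃ (γ₁ C c : ℝ) (N : ℕ), 0 < γ₁ ∧ γ₁ ≤ 1 ∧ 0 < c ∧ 0 ≤ C ∧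
      ∀ (F : T3Family) (γ : ℝ), F.L = L → 0 < γ → γ ≤ γ₁ → ∀ (K : ℕ), 2 ≤ K → ∀ p : Plaq (F.P K) K,
        (gibbsK F ℰp γ K).real {U | (∀ k, k < K → PlaqSmall (θBal F.L γ b₀ p₀ (K - k))
            (Averaging.iter (fun i => BlockAveraging.blockAvg (P := F.P K) (j := i) ℰp) k U)) ∧
          θBal F.L γ b₀ p₀ 0 ≤ GaugeGroup.dist1 (GaugeField.plaqHol
            (Averaging.iter (fun i => BlockAveraging.blockAvg (P := F.P K) (j := i) ℰp) K U) p)} ≤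
        C * (γ⁻¹) ^ N * Real.exp (-(c * B10.pFun b₀ p₀ (Real.sqrt γ) ^ 2))) :
    Summit.QuantumFields.YangMills.Theses.SmallFieldWidening.LargeFieldMassRefinementTail :=
  FirstExitWindow.largeFieldMassRefinementTail_of_firstExitDeep (deepStub_iff_unitTop.mpr hU)

/-- **K2′ `HistoryTailL` (crux stmt-QuantumFields-19936) ⇐ THE UNIT-TOP TAIL.**  Conditional certificate; nothing about the mass gap.
[cite: Balaban1985UV3, (7) p.257 and (71) p.273] -/
theorem historyTailL_of_unitTop
    (hU : ∀ (L : ℕ) (b₀ p₀ : ℝ), 0 < b₀ → 2 < p₀ → ∃ (γ₁ C c : ℝ) (N : ℕ), 0 < γ₁ ∧ γ₁ ≤ 1 ∧ 0 < c ∧ 0 ≤ C ∧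
      ∀ (F : T3Family) (γ : ℝ), F.L = L → 0 < γ → γ ≤ γ₁ → ∀ (K : ℕ), 2 ≤ K → ∀ p : Plaq (F.P K) K,
        (gibbsK F ℰp γ K).real {U | (∀ k, k < K → PlaqSmall (θBal F.L γ b₀ p₀ (K - k))
            (Averaging.iter (fun i => BlockAveraging.blockAvg (P := F.P K) (j := i) ℰp) k U)) ∧
          θBal F.L γ b₀ p₀ 0 ≤ GaugeGroup.dist1 (GaugeField.plaqHol
            (Averaging.iter (fun i => BlockAveraging.blockAvg (P := F.P K) (j := i) ℰp) K U) p)} ≤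
        C * (γ⁻¹) ^ N * Real.exp (-(c * B10.pFun b₀ p₀ (Real.sqrt γ) ^ 2))) :
    Summit.QuantumFields.YangMills.Theses.UnitScaleTilt.HistoryTailL :=
  FirstExitWindow.unitScaleTilt_historyTailL_of_firstExitDeep (deepStub_iff_unitTop.mpr hU)

end NormalForm

end Summit.QuantumFields.YangMills.Theorems.LargeFieldMassRefinementTailUnitTop

end
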